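import Literature.NumberTheory.Automorphic.UnitaryGroupCotangentSpectralProjection
import Literature.NumberTheory.Automorphic.UnitaryGroupCongruenceLevels
import Summits.HodgeConjecture.HodgeConjecture.Theorems.H413SpectrumJunction
import Summits.HodgeConjecture.HodgeConjecture.Theorems.F0P2aStubArchOrthAntiholOfHol
import Summits.HodgeConjecture.HodgeConjecture.Theorems.F0P2aStubS1SesqSchur
import Summits.HodgeConjecture.HodgeConjecture.Theorems.F0P2aStubAdmissibleOfCohValued
import Summits.HodgeConjecture.HodgeConjecture.Theorems.F0P2aStubDensity
import Summits.HodgeConjecture.HodgeConjecture.Theorems.F0P2aCohFormsContinuous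
import Summits.HodgeConjecture.HodgeConjecture.Theorems.F0P2aL2aKSchur
import Summits.HodgeConjecture.HodgeConjecture.Theorems.F0P2aL2bHolArchSmooth
import Summits.HodgeConjecture.HodgeConjecture.Theorems.F0P2aL2bSliceContinuous
import Summits.HodgeConjecture.HodgeConjecture.Theorems.F0P2aStubL2dNelson
import Summits.HodgeConjecture.HodgeConjecture.Theorems.F0P2aL2eExpGeneration
import Summits.HodgeConjecture.HodgeConjecture.Theorems.F0P2aL2cOrderedProducts
import Summits.HodgeConjecture.HodgeConjecture.Theorems.F0P2aArchOrthHolOfCuts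
import Summits.HodgeConjecture.HodgeConjecture.Theses.HCCMUnconditional
import Mathlib.Analysis.InnerProductSpace.PiL2
import HarnessLib

set_option linter.dupNamespace false

/-!
# F0-P2a · line 2 (B4-ARCHIMEDEAN DESK) — the isotypic-line letter (E) `cohIsotypicLine_hol / _antihol` by the
# ORTHOGONALITY BOOTSTRAP (crux `H413`, route `HCCMUnconditional`; served item `stmt-HodgeConjecture-24833`)

Unit `hodgecm-mathlib-F0P2a-plan` (g2), HOME `pub/hodgecm-mathlib/F0/P2a/`.  Namespace
`Summit.HodgeConjecture.HodgeConjecture.Cruxes.H413.F0P2aCohIsotypicLine`.  Companion of the first desk line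
`Cruxes/H413/Lines/F0_P2aHodgeRealisation.lean` (B1a/B1b/B3/B4, all four consumer heads now ★).

## What this line delivers
The registered hJ3a skeleton `Cruxes/H413/Lines/F0_U3CohMultOne.lean` (v1.3, sorries = S3, S4, S5) closes `stub_S3_holLineAt` /
`stub_S4_antiholLineAt` through F0P3-p03's folds `stubS3_of_letters hE1 hE1' hD hEhol hcont` / `stubS4_of_letters … hEantihol …`, whose
binders `hEhol` / `hEantihol` are — TOKEN FOR TOKEN — the conclusions of the two HEADS of this file:

* `cohIsotypicLineAdm_hol_of     : SesqSchurType → ArchOrthHolType → DensityType → (hEhol text)`      (sorry-free composition),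
* `cohIsotypicLineAdm_antihol_of : SesqSchurType → ArchOrthAntiholType → DensityType → (hEantihol text)` (sorry-free composition),

i.e. «for `σ` irreducible smooth ADMISSIBLE and `P` discrete automorphic, the `σ`-equivariant linear maps `ψ : σ → {Φ ∈ hol ∣ P.ContainsForm Φ}`
lie on one line» ([Liu2021, Lem. D.2 (2)]: `dim H¹(𝔤,K;J^±)_{τ′} ≤ 1`; [BorelWallach2000, VI 4.11, VII 3.2]).  The filed Literature letters
★ `CotangentForms.cohIsotypicLine_hol/antihol` (no admissibility binder) follow from the same heads plus ONE more stub
(`AdmissibleOfCohValuedType`, §1 S3): heads `cohIsotypicLine_hol_of`, `cohIsotypicLine_antihol_of`.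

## The mechanism (why no Flath ⊗′, no `(𝔤,K)`-cohomology, no PBW is needed)
Let `ψ₁ ≠ 0` and `ψ` be two such maps.  (1) The coordinate `L²`-classes `Λᵢ j w := [toQuotFun (ψᵢ w · j)] ∈ P ⊂ L²` are linear in `w`
and intertwine `σ` with `R|_{G_f}` (★ `toLp_toQuotFun_mul_right`), so the two sesquilinear forms `bᵢ(w,w') := ∑ⱼ ⟪Λ₁ j w, Λᵢ j w'⟫` on `W`
are `G_f`-INVARIANT (`R` unitary).  (2) **`SesqSchurType`** (Schur for invariant sesquilinear forms on an irreducible ADMISSIBLE `σ` of a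
group with a compact open subgroup — eigenvector of the Riesz operator on the finite-dimensional `W^K`, finite averaging, irreducibility):
`b₂ = c · b₁`.  (3) Hence `ψ₃ := ψ − c • ψ₁` has `∑ⱼ ⟪Λ₁ j w, Λ₃ j w'⟫ = 0` for all `w, w'`.  (4) **`ArchOrthHolType`** (the archimedean
core, pure `U(2,1)`-analysis on a PAIR of holomorphic cotangent forms `Φ, Φ₃`: `K_∞`-Schur on the irreducible cotangent `K`-type upgrades
trace-orthogonality to orthogonality of all coordinate classes; `𝔭⁻ Φ = 0`, `[𝔭⁻,𝔭⁺] ⊆ 𝔨`, ordered products `U(𝔤) = U(𝔭⁺)U(𝔨)U(𝔭⁻)` and the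
`z₀`-grading make `[Φ₃]` orthogonal to the whole `U(𝔤)`-span of the classes of `Φ`; Harish-Chandra's closure theorem ★
`closure_l2OfForms_exp_invariant_of_analytic` with Nelson analyticity of `K`-finite `Z(𝔤)`-finite bounded vectors (★ `NelsonSumOfSquares`,
`OneParameterAnalyticVector`, the GL_n template `AutomorphicRepsGLAnalyticVectors`) and connectedness of `U(2,1)` give
`⟪R(ι_∞ u)[Φ]ⱼ, [Φ₃]ⱼ'⟫ = 0` for every `u ∈ U(2,1)`).  (5) **`DensityType`** (honest factorisation `U(H)(𝔸) = ι_∞(U(2,1))·K_c·U(H)(𝔸_f)` ★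
`archFactorAt_isHonest_cm`, `K_c`-invariance, `G_f`-stability of `ψ₁(W)`, topological irreducibility of `P`, continuity + ★
`toLp_toQuotFun_ne_zero`): `ψ₃ w' = 0`.  So `ψ = c • ψ₁`.  The antiholomorphic letter is the mirror (`𝔭⁺ ↔ 𝔭⁻`, or complex conjugation on
`L²`), with the same (1)(2)(3)(5).

## Stubs (registered names `stub_*`; sizes S/M/L = ≤ 0.3 / ≤ 1 / > 1 kloc)
* S1 `stub_sesqSchur : SesqSchurType` — since ed. 2 FOLDED onto ★ p795696 `Theorems/F0P2aStubS1SesqSchur.lean` (F0P2a-p04).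
* S2⁺ `stub_archOrth_hol : ArchOrthHolType` (L, HARDEST — the archimedean core) — since ed. 4 SPLIT into the six registered sub-stubs of
  §1b (`stub_L2a`, `stub_L2bi`, `stub_L2bii`, `stub_L2c`, `stub_L2d`, `stub_L2e`, all FOLDED onto ★ Theorems files) and FOLDED onto the lead's
  ★ p797432 composition `F0P2aArchOrthHol.archOrthHol_of_cuts stub_L2a stub_L2bi stub_L2bii stub_L2c stub_L2d stub_L2e` (F0P2a-p01).
* S2⁻ `stub_archOrth_antihol : ArchOrthAntiholType` — since ed. 2 DERIVED (no `sorry`): `:= F0P2aArchOrthAntihol.archOrth_antihol_of_hol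
  stub_archOrth_hol` (★ p795253 `Theorems/F0P2aStubArchOrthAntiholOfHol.lean`, F0P2a-p06: complex conjugation on `L²`).
* S2β `stub_density : DensityType` — since ed. 3 FOLDED onto ★ p795563 `densityType_of_continuous` + ★ p796556 `continuous_of_mem_cohForms_frame` (F0P2a-p05, F0P2a-p03).
* S3 `stub_admissible_of_cohValued : AdmissibleOfCohValuedType` — since ed. 3 FOLDED onto ★ p796549 `Theorems/F0P2aStubAdmissibleOfCohValued.lean` (F0P2a-p07).

## Honest label
HC_CM is proved only modulo the printed citations until rung 0 closes.  This file is a LINE SKELETON: `sorry` occurs exactly in the OPEN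
`stub_*` theorems listed under «Editions» below; every other declaration is a real proof.  Since ed. 4 there is NO open stub: the file is
`sorry`-free and every registered statement of §1/§1b has a kernel-closed witness in `Theorems/` (the line is CLOSED as a skeleton).

## Editions (registrar A-plan1; bytes F0P2a-plan; statements of §1 NEVER change — only stub BODIES are folded onto ★ Theorems files)
* ed. 1 (F0P2a-plan g2, 2026-08-30T23:04Z, sha16 fe64be0a9875628f): five open stubs S1, S2⁺, S2⁻, S2β, S3.
* ed. 2 (F0P2a-plan g3, 2026-08-30T23:45Z; director s355 cure: `[cite: …]` tags inside `def`/`abbrev` docstrings rewritten as prose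
  `(print: …)`, theorem tags kept): S2⁻ folded onto ★ p795253 (`archOrth_antihol_of_hol stub_archOrth_hol`) and S1 folded onto ★ p795696 `Theorems/F0P2aStubS1SesqSchur.lean` (`stubS1_holds`, F0P2a-p04);
  open stubs = S2⁺, S2β, S3 (3 `sorry`).  Next folds by name as they land:
  S2β `F0P2aStubDensityHolds.stub_density_holds` (F0P2a-p05, = ★ p795563 `densityType_of_continuous` + B5 `F0P2aCohFormsContinuous`, F0P2a-p03),
  S3 `F0P2aStubAdmissibleOfCohValued…` (F0P2a-p07, via ★ `F0P2aCohFormsFixedFinite` + `F0P2aFrameTransport`, F0P2a-p06);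
  S2⁺ is SPLIT in ed. 3 into registered sub-stubs L2a–L2d with the kernel-checked composition `archOrthHol_of_cuts` (lead F0P2a-p01).
* ed. 3 (F0P2a-plan g3, 2026-08-31T00:05Z): S3 folded onto ★ p796549 `Theorems/F0P2aStubAdmissibleOfCohValued.lean` (`stubS3_holds`,
  F0P2a-p07) and S2β folded onto ★ p795563 `F0P2aStubDensity.densityType_of_continuous` applied to ★ p796556
  `F0P2aCohFormsContinuous.continuous_of_mem_cohForms_frame` (F0P2a-p05 + B5 F0P2a-p03); open stubs = S2⁺ ONLY (1 `sorry`).  ED. 4 = the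
  S2⁺ SPLIT: registered sub-stubs `stub_L2a` (★ `F0P2aL2aKSchur.l2a_holds`, F0P2a-p04), `stub_L2bi` / `stub_L2bii` (F0P2a-p03, on ★ p796535
  `F0P2aL2bMatrixChartSmooth`), `stub_L2c` (F0P2a-p08 over A-p08 `F0P2aL2cPNullSpanOrthogonal`), L2d imported by name (★ p796713
  `Literature/…/U21AnalyticVectors`, ★ p796547 `F0P2aL2dNelsonU21`, F0P2a-p02), composition `archOrthHol_of_cuts` (lead F0P2a-p01).
* ed. 4 (F0P2a-plan g3, 2026-08-31T00:20Z): the S2⁺ SPLIT, registered — §1b adds the six sub-stub STATEMENTS `L2aKSchurType`,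
  `L2bHolArchSmoothType`, `L2bSliceContinuousType`, `L2cOrderedProductsType`, `L2dAnalyticVectorsType`, `L2eExpGenerationType` (= the
  hypotheses hA, hBi, hBii, hC, hD, hE of ★ p797432 `Theorems/F0P2aArchOrthHolOfCuts.lean :: archOrthHol_of_cuts`, token for token) with
  `stub_L2a` := ★ p796687 `F0P2aL2aKSchur.l2a_holds` (F0P2a-p04), `stub_L2bi` := ★ p796944 `F0P2aL2bHolArchSmooth.sig_L2Bi_holds` and
  `stub_L2bii` := ★ p796634 `F0P2aL2bSliceContinuous.sig_L2Bii_holds` (F0P2a-p03), `stub_L2c` := ★ p797086 `F0P2aL2cOrderedProducts.sig_L2C_holds`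
  (F0P2a-p08 over A-p08's ★ p796527 engine `F0P2aL2cPNullSpanOrthogonal`), `stub_L2d` := ★ p797110 `F0P2aStubL2dNelson.stub_L2d_holds`
  (F0P2a-p02, = ★ p796713 `Literature/NumberTheory/Automorphic/U21AnalyticVectors`), `stub_L2e` := ★ p797102
  `F0P2aL2eExpGeneration.subgroup_eq_top_of_forall_expMem_mem` (F0P2a-p01); S2⁺ `stub_archOrth_hol := archOrthHol_of_cuts stub_L2a … stub_L2e`.
  Open stubs = NONE (0 `sorry`); referee legs REF-CERT-4/5 (F0P2a-ref1), reader certs F0P2a-p04 (g2), F0P2a-p07.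

## References
[Liu2021] Y. Liu, arXiv:2106.08732, App. D, Lem. D.2 (2) · [BorelWallach2000] A. Borel, N. Wallach, *Continuous cohomology…*, 2nd ed., VI 4.11,
VII 2.10/3.2 · [HarishChandraTAMS1953] Harish-Chandra, Trans. AMS 75 (1953), Cor. to Thm 2, Lemma 34 · [Nelson1959] E. Nelson, Ann. Math. 70 ·
[BorelJacquet1979] A. Borel, H. Jacquet, Corvallis §4 · [BernsteinZelevinsky1976] (admissible representations) · [Rogawski1990] Prop. 15.2.1 (b).
-/

noncomputable section

open MeasureTheory NumberField
open scoped InnerProductSpace ENNReal ComplexOrder Matrix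

namespace Summit.HodgeConjecture.HodgeConjecture.Cruxes.H413.F0P2aCohIsotypicLine

open Literature.NumberTheory.Automorphic Literature.NumberTheory.Automorphic.UnitaryGroup
open Literature.NumberTheory.Automorphic.UnitaryGroup.CotangentForms (toQuotFun cmArchSection cmCompactFactor)
open Summit.HodgeConjecture.HodgeConjecture.Cruxes.H413.SpectrumJunction

/-! ## §0 Abbreviations for the CM engine datum `(L, ι, H, T, hT)` (reducible; no notation) -/

section Abbrev

variable (L : Type) [Field L] [NumberField L] [IsCMField L]

/-- `U(H)` over `𝔸_{L⁺}` as an adelic group datum. (print: BorelJacquet1979, §4.1) -/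
abbrev 𝒰 (H : Matrix (Fin 3) (Fin 3) L) : AdelicGroupData ↥(maximalRealSubfield L) :=
  adelicGroupData (↥(maximalRealSubfield L)) L (IsCMField.complexConj L) 3 H

/-- `U(H)(𝔸_{L⁺,f})`. (print: BorelJacquet1979, §4.1) -/
abbrev Gf (H : Matrix (Fin 3) (Fin 3) L) := finAdelic (↥(maximalRealSubfield L)) L (IsCMField.complexConj L) 3 H

/-- Right translation by `U(H)(𝔸_{L⁺,f})` on `ℂ²`-valued functions. (print: BorelJacquet1979, §4.2) -/
abbrev Rf (H : Matrix (Fin 3) (Fin 3) L) := CotangentForms.rightRep (↥(maximalRealSubfield L)) L (IsCMField.complexConj L) 3 H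

/-- The holomorphic cotangent automorphic forms of the CM archimedean factor `(cmArchSection, cmCompactFactor)`.
(print: BorelWallach2000, VII 2.10) -/
abbrev hol (ι : L →+* ℂ) (H : Matrix (Fin 3) (Fin 3) L) (T : GL (Fin 3) ℂ)
    (hT : (T : Matrix (Fin 3) (Fin 3) ℂ)ᴴ * H.map ι * (T : Matrix (Fin 3) (Fin 3) ℂ) = Literature.Geometry.ComplexHyperbolic.BallModel.J) :=
  CotangentForms.holCotForms (↥(maximalRealSubfield L)) L (IsCMField.complexConj L) 3 H (cmArchSection L ι H T hT) (cmCompactFactor L ι H T hT)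

/-- Their complex conjugates (antiholomorphic cotangent forms). (print: BorelWallach2000, VII 2.10) -/
abbrev antihol (ι : L →+* ℂ) (H : Matrix (Fin 3) (Fin 3) L) (T : GL (Fin 3) ℂ)
    (hT : (T : Matrix (Fin 3) (Fin 3) ℂ)ᴴ * H.map ι * (T : Matrix (Fin 3) (Fin 3) ℂ) = Literature.Geometry.ComplexHyperbolic.BallModel.J) :=
  (hol L ι H T hT).map (CotangentForms.conjFun (↥(maximalRealSubfield L)) L (IsCMField.complexConj L) 3 H)

/-- The `(1,0) ⊕ (0,1)` cohomological cotangent forms of the CM factor. (print: BorelWallach2000, VII 2.10) -/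
abbrev coh (ι : L →+* ℂ) (H : Matrix (Fin 3) (Fin 3) L) (T : GL (Fin 3) ℂ)
    (hT : (T : Matrix (Fin 3) (Fin 3) ℂ)ᴴ * H.map ι * (T : Matrix (Fin 3) (Fin 3) ℂ) = Literature.Geometry.ComplexHyperbolic.BallModel.J) :=
  CotangentForms.cohForms (↥(maximalRealSubfield L)) L (IsCMField.complexConj L) 3 H (cmArchSection L ι H T hT) (cmCompactFactor L ι H T hT)

end Abbrev

/-! ## §1 The stub STATEMENTS (closed `Prop`s) -/

/-- **S1 · Schur for invariant sesquilinear forms on an irreducible admissible representation.**  `G` a topological group possessing a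
compact open subgroup, `σ` an irreducible ADMISSIBLE representation of `G` on `W` (no topology on `W`), `φ₁ φ₂ : W → V` linear maps to a
complex inner-product space such that the two sesquilinear forms `⟪φ₁ ·, φ₁ ·⟫` and `⟪φ₁ ·, φ₂ ·⟫` are `σ(G)`-invariant.  Then
`⟪φ₁ w, φ₂ w'⟫ = c · ⟪φ₁ w, φ₁ w'⟫` for one constant `c`.  (Proof sketch: if `φ₁ = 0` trivial; else `ker φ₁` is stable hence `0`, so
`b₁ = ⟪φ₁·,φ₁·⟫` is an inner product on `W`; on the finite-dimensional `W^K` (`K` compact open fixing a given `w' ≠ 0`) the Riesz operator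
`A` with `b₂(w,w') = b₁(w, A w')` has an eigenvector; finite averaging over `K / (K ∩ Stab w)` (★ `exists_average_family`) extends the
eigen-relation to all `w ∈ W`; `{w' ∣ ∀ w, b₂(w,w') = λ b₁(w,w')}` is a non-zero stable subspace, hence `W`.)
(print: BernsteinZelevinsky1976, §2) (print: Bump1997, Proposition 4.2.4) -/
def SesqSchurType : Prop :=
  ∀ (G : Type) [Group G] [TopologicalSpace G] [IsTopologicalGroup G] (W : Type) [AddCommGroup W] [Module ℂ W]
    (σ : Representation ℂ G W), σ.IsIrreducible → σ.IsAdmissible → (∃ K : OpenSubgroup G, IsCompact (K : Set G)) →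
    ∀ (V : Type) [NormedAddCommGroup V] [InnerProductSpace ℂ V] (φ₁ φ₂ : W →ₗ[ℂ] V),
      (∀ (g : G) (w w' : W), ⟪φ₁ (σ g w), φ₁ (σ g w')⟫_ℂ = ⟪φ₁ w, φ₁ w'⟫_ℂ) →
      (∀ (g : G) (w w' : W), ⟪φ₁ (σ g w), φ₂ (σ g w')⟫_ℂ = ⟪φ₁ w, φ₂ w'⟫_ℂ) →
      ∃ c : ℂ, ∀ w w' : W, ⟪φ₁ w, φ₂ w'⟫_ℂ = c * ⟪φ₁ w, φ₁ w'⟫_ℂ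

/-- **S2⁺ · archimedean orthogonality for a PAIR of holomorphic cotangent forms (the archimedean core).**  For the CM engine datum
(`H` of signature `(2,1)` at `ι`, definite elsewhere, `[L⁺:ℚ] ≥ 2`), an automorphic measure `μ`, and two holomorphic cotangent forms
`Φ, Φ₃` with square-integrable coordinate classes: if the TRACE pairing `∑ⱼ ⟪[Φ]ⱼ, [Φ₃]ⱼ⟫_{L²}` vanishes, then EVERY archimedean translate of
every coordinate class of `Φ` is orthogonal to every coordinate class of `Φ₃`: `⟪R(ι_∞ u)[Φ]ⱼ, [Φ₃]ⱼ'⟫ = 0` (`u ∈ U(2,1)`).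
Route: `K_∞`-Schur (cotangent `K`-type irreducible) ⇒ all `⟪[Φ]ⱼ,[Φ₃]ⱼ'⟫ = 0`; `𝔭⁻`-annihilation (★ CR dictionary
`UnitaryBallLieDerivative`), `U(𝔤) = U(𝔭⁺)U(𝔨)U(𝔭⁻)`, `z₀`-weights ⇒ `[Φ₃] ⊥ U(𝔤)·[Φ]`; Nelson analyticity + Harish-Chandra closure ★
`closure_l2OfForms_exp_invariant_of_analytic` + `U(2,1)` connected ⇒ `[Φ₃] ⊥ R(ι_∞ U(2,1))·[Φ]`.  Why it might fail: only through a
regularity gap (`IsHolGerm` is first-order; smoothness along `ι_∞` must be derived — Goursat/Osgood on the ball).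
(print: HarishChandraTAMS1953, Cor. to Thm 2; Lemma 34) (print: Nelson1959) (print: BorelWallach2000, VII 2.10, 3.2) (print: Liu2021, Lem. D.2 (2)) -/
def ArchOrthHolType : Prop :=
  ∀ (L : Type) [Field L] [NumberField L] [IsCMField L] (ι : L →+* ℂ) (H : Matrix (Fin 3) (Fin 3) L) (T : GL (Fin 3) ℂ)
    (hT : (T : Matrix (Fin 3) (Fin 3) ℂ)ᴴ * H.map ι * (T : Matrix (Fin 3) (Fin 3) ℂ) = Literature.Geometry.ComplexHyperbolic.BallModel.J),
    (∀ τ' : L →+* ℂ, InfinitePlace.mk τ' ≠ InfinitePlace.mk ι → (H.map τ').PosDef) →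
    2 ≤ Module.finrank ℚ ↥(maximalRealSubfield L) →
    ∀ (μ : Measure (𝒰 L H).automorphicQuotient) [(𝒰 L H).IsAutomorphicMeasure μ]
      (Φ Φ₃ : (𝒰 L H).Adelic → (Fin 2 → ℂ)), Φ ∈ hol L ι H T hT → Φ₃ ∈ hol L ι H T hT →
    ∀ (hΦ : ∀ j : Fin 2, MemLp (toQuotFun (𝒰 L H) fun x => Φ x j) 2 μ)
      (h₃ : ∀ j : Fin 2, MemLp (toQuotFun (𝒰 L H) fun x => Φ₃ x j) 2 μ),
    ∑ j : Fin 2, ⟪(hΦ j).toLp (toQuotFun (𝒰 L H) fun x => Φ x j), (h₃ j).toLp (toQuotFun (𝒰 L H) fun x => Φ₃ x j)⟫_ℂ = 0 →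
    ∀ (u : Literature.Geometry.ComplexHyperbolic.BallModel.U21) (j j' : Fin 2),
      ⟪(𝒰 L H).rightRegular μ (cmArchSection L ι H T hT u) ((hΦ j).toLp (toQuotFun (𝒰 L H) fun x => Φ x j)),
        (h₃ j').toLp (toQuotFun (𝒰 L H) fun x => Φ₃ x j')⟫_ℂ = 0

/-- **S2⁻ · archimedean orthogonality for a pair of ANTIholomorphic cotangent forms** — the mirror of S2⁺ (`𝔭⁺ ↔ 𝔭⁻`), or S2⁺ transported
by the anti-unitary complex conjugation of `L²` (which commutes with `R` and maps `[Φ]ⱼ` to `[Φ̄]ⱼ`).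
(print: BorelWallach2000, VII 2.10) (print: HarishChandraTAMS1953, Cor. to Thm 2) -/
def ArchOrthAntiholType : Prop :=
  ∀ (L : Type) [Field L] [NumberField L] [IsCMField L] (ι : L →+* ℂ) (H : Matrix (Fin 3) (Fin 3) L) (T : GL (Fin 3) ℂ)
    (hT : (T : Matrix (Fin 3) (Fin 3) ℂ)ᴴ * H.map ι * (T : Matrix (Fin 3) (Fin 3) ℂ) = Literature.Geometry.ComplexHyperbolic.BallModel.J),
    (∀ τ' : L →+* ℂ, InfinitePlace.mk τ' ≠ InfinitePlace.mk ι → (H.map τ').PosDef) →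
    2 ≤ Module.finrank ℚ ↥(maximalRealSubfield L) →
    ∀ (μ : Measure (𝒰 L H).automorphicQuotient) [(𝒰 L H).IsAutomorphicMeasure μ]
      (Φ Φ₃ : (𝒰 L H).Adelic → (Fin 2 → ℂ)), Φ ∈ antihol L ι H T hT → Φ₃ ∈ antihol L ι H T hT →
    ∀ (hΦ : ∀ j : Fin 2, MemLp (toQuotFun (𝒰 L H) fun x => Φ x j) 2 μ)
      (h₃ : ∀ j : Fin 2, MemLp (toQuotFun (𝒰 L H) fun x => Φ₃ x j) 2 μ),
    ∑ j : Fin 2, ⟪(hΦ j).toLp (toQuotFun (𝒰 L H) fun x => Φ x j), (h₃ j).toLp (toQuotFun (𝒰 L H) fun x => Φ₃ x j)⟫_ℂ = 0 →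
    ∀ (u : Literature.Geometry.ComplexHyperbolic.BallModel.U21) (j j' : Fin 2),
      ⟪(𝒰 L H).rightRegular μ (cmArchSection L ι H T hT u) ((hΦ j).toLp (toQuotFun (𝒰 L H) fun x => Φ x j)),
        (h₃ j').toLp (toQuotFun (𝒰 L H) fun x => Φ₃ x j')⟫_ℂ = 0

/-- **S2β · density / irreducibility.**  `N` a non-zero `U(H)(𝔸_f)`-stable space of cohomological cotangent forms whose classes lie in the
discrete automorphic representation `P`, and `Φ₃` a cohomological cotangent form with classes in `P`.  If every ARCHIMEDEAN translate of every
coordinate class of every `Φ ∈ N` is orthogonal to the coordinate classes of `Φ₃`, then `Φ₃ = 0`.  Route: by the honest factorisation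
`U(H)(𝔸_{L⁺}) = ι_∞(U(2,1)) · K_c · U(H)(𝔸_{L⁺,f})` (★ `archFactorAt_isHonest_cm`), `K_c`-invariance of cohomological forms and
`G_f`-stability of `N`, the classes of `Φ₃` are orthogonal to the closed `U(H)(𝔸)`-span of the classes of `N`, a non-zero closed invariant
subspace of the topologically irreducible `P` (★ `DiscreteAutomorphicRep.irreducible`), i.e. to `P` itself; so they vanish, and `Φ₃ = 0` by
continuity (★ `toLp_toQuotFun_ne_zero`, `μ` positive on opens).  Why it might fail: continuity of cohomological forms on `U(H)(𝔸)` is not a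
field of ★ `holCotForms` and must be derived (first-order germs + `K`-type + smooth vectors + product topology).
(print: BorelJacquet1979, §4.6) (print: GelfandGraevPiatetskiShapiro1969, Ch. 1 §2.3) -/
def DensityType : Prop :=
  ∀ (L : Type) [Field L] [NumberField L] [IsCMField L] (ι : L →+* ℂ) (H : Matrix (Fin 3) (Fin 3) L) (T : GL (Fin 3) ℂ)
    (hT : (T : Matrix (Fin 3) (Fin 3) ℂ)ᴴ * H.map ι * (T : Matrix (Fin 3) (Fin 3) ℂ) = Literature.Geometry.ComplexHyperbolic.BallModel.J),
    (∀ τ' : L →+* ℂ, InfinitePlace.mk τ' ≠ InfinitePlace.mk ι → (H.map τ').PosDef) →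
    2 ≤ Module.finrank ℚ ↥(maximalRealSubfield L) →
    ∀ (μ : Measure (𝒰 L H).automorphicQuotient) [(𝒰 L H).IsAutomorphicMeasure μ] (P : DiscreteAutomorphicRep (𝒰 L H) μ)
      (N : Submodule ℂ ((𝒰 L H).Adelic → (Fin 2 → ℂ))), N ≤ coh L ι H T hT →
    (∀ Φ ∈ N, P.ContainsForm Φ) → (∀ (g : Gf L H), ∀ Φ ∈ N, Rf L H g Φ ∈ N) → N ≠ ⊥ →
    ∀ Φ₃ ∈ coh L ι H T hT, P.ContainsForm Φ₃ →
    (∀ Φ ∈ N, ∀ (hΦ : ∀ j : Fin 2, MemLp (toQuotFun (𝒰 L H) fun x => Φ x j) 2 μ)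
        (h₃ : ∀ j : Fin 2, MemLp (toQuotFun (𝒰 L H) fun x => Φ₃ x j) 2 μ),
      ∀ (u : Literature.Geometry.ComplexHyperbolic.BallModel.U21) (j j' : Fin 2),
        ⟪(𝒰 L H).rightRegular μ (cmArchSection L ι H T hT u) ((hΦ j).toLp (toQuotFun (𝒰 L H) fun x => Φ x j)),
          (h₃ j').toLp (toQuotFun (𝒰 L H) fun x => Φ₃ x j')⟫_ℂ = 0) →
    Φ₃ = 0

/-- **S3 · admissibility for free (only for the admissibility-free filed letters).**  An irreducible SMOOTH `σ` of `U(H)(𝔸_{L⁺,f})` admitting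
a NON-ZERO equivariant linear map into the cohomological cotangent forms of the CM factor is admissible: `ψ` is injective (Schur) and
`ψ(W^K) ⊆ {level-K cohomological cotangent forms} ≅ H^{1,0} ⊕ H^{0,1}` of the compact level-`K` ball quotient, finite-dimensional.
Route: the desk isomorphism ★ `CuspCot.exists_cohClassMap_bijective` / `t2Bijective_pin` (p793103) and ★ `TowerConj.exists_H10T_add_conjT`
at the pin `archFactorOf F V`, transported to the frame `(T, hT)` (★ `exists_archFactor`, `archFactorAt_isHonest_cm`).  Why it might fail:
only the frame transport `(L, ι, H, T)` ↦ pin is not yet a ★ lemma. (print: BorelWallach2000, VII 3.2) (print: BernsteinZelevinsky1976, §2) -/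
def AdmissibleOfCohValuedType : Prop :=
  ∀ (L : Type) [Field L] [NumberField L] [IsCMField L] (ι : L →+* ℂ) (H : Matrix (Fin 3) (Fin 3) L) (T : GL (Fin 3) ℂ)
    (hT : (T : Matrix (Fin 3) (Fin 3) ℂ)ᴴ * H.map ι * (T : Matrix (Fin 3) (Fin 3) ℂ) = Literature.Geometry.ComplexHyperbolic.BallModel.J),
    (∀ τ' : L →+* ℂ, InfinitePlace.mk τ' ≠ InfinitePlace.mk ι → (H.map τ').PosDef) →
    2 ≤ Module.finrank ℚ ↥(maximalRealSubfield L) →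
    ∀ (W : Type) [AddCommGroup W] [Module ℂ W] (σ : Representation ℂ (Gf L H) W), σ.IsIrreducible → σ.IsSmooth →
    ∀ ψ : W →ₗ[ℂ] ((𝒰 L H).Adelic → (Fin 2 → ℂ)),
      (∀ (g : Gf L H) (w : W), ψ (σ g w) = Rf L H g (ψ w)) → (∀ w : W, ψ w ∈ coh L ι H T hT) → ψ ≠ 0 →
      σ.IsAdmissible

/-! ## §1b The S2⁺ CUT (ed. 4) — registered sub-stub STATEMENTS = the six hypotheses of ★ `F0P2aArchOrthHol.archOrthHol_of_cuts`
(lead F0P2a-p01, `Theorems/F0P2aArchOrthHolOfCuts.lean`), TOKEN FOR TOKEN; `stub_archOrth_hol` is folded onto that composition in §2. -/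

section L2Cuts

open Literature.NumberTheory.Automorphic.UnitaryGroup.CotangentForms (holCotForms)
open Literature.Geometry.ComplexHyperbolic Literature.Geometry.ComplexHyperbolic.BallModel
open Literature.AlgebraicGeometry.ShimuraVarieties Literature.AlgebraicGeometry.ShimuraVarieties.BallForms

/-- L2A — K∞-SCHUR (F0P2a-p04; closer ★ p796687 `F0P2aL2aKSchur.l2a_holds`): a trace-orthogonal pair of holomorphic cotangent forms of the CM frame has ALL coordinate classes orthogonal. (print: Knapp1986 Prop. 8.5; BorelWallach2000 VII 2.10) -/
def L2aKSchurType : Prop :=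
  ∀ (L : Type) [Field L] [NumberField L] [IsCMField L] (ι : L →+* ℂ) (H : Matrix (Fin 3) (Fin 3) L) (T : GL (Fin 3) ℂ)
    (hT : (T : Matrix (Fin 3) (Fin 3) ℂ)ᴴ * H.map ι * (T : Matrix (Fin 3) (Fin 3) ℂ) = Literature.Geometry.ComplexHyperbolic.BallModel.J)
    (μ : Measure (adelicGroupData (↥(maximalRealSubfield L)) L (IsCMField.complexConj L) 3 H).automorphicQuotient)
    [(adelicGroupData (↥(maximalRealSubfield L)) L (IsCMField.complexConj L) 3 H).IsAutomorphicMeasure μ]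
    (Φ Φ₃ : (adelicGroupData (↥(maximalRealSubfield L)) L (IsCMField.complexConj L) 3 H).Adelic → (Fin 2 → ℂ)),
    Φ ∈ holCotForms (↥(maximalRealSubfield L)) L (IsCMField.complexConj L) 3 H (cmArchSection L ι H T hT) (cmCompactFactor L ι H T hT) →
    Φ₃ ∈ holCotForms (↥(maximalRealSubfield L)) L (IsCMField.complexConj L) 3 H (cmArchSection L ι H T hT) (cmCompactFactor L ι H T hT) →
    ∀ (hΦ : ∀ j : Fin 2, MemLp (toQuotFun (adelicGroupData (↥(maximalRealSubfield L)) L (IsCMField.complexConj L) 3 H) fun x => Φ x j) 2 μ)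
    (h₃ : ∀ j : Fin 2, MemLp (toQuotFun (adelicGroupData (↥(maximalRealSubfield L)) L (IsCMField.complexConj L) 3 H) fun x => Φ₃ x j) 2 μ),
    ∑ j : Fin 2, ⟪(hΦ j).toLp (toQuotFun _ fun x => Φ x j), (h₃ j).toLp (toQuotFun _ fun x => Φ₃ x j)⟫_ℂ = 0 →
    ∀ j j' : Fin 2, ⟪(hΦ j).toLp (toQuotFun _ fun x => Φ x j), (h₃ j').toLp (toQuotFun _ fun x => Φ₃ x j')⟫_ℂ = 0

/-- L2B-i — ARCHIMEDEAN SMOOTHNESS (F0P2a-p03; closer ★ `F0P2aL2bHolArchSmooth.sig_L2Bi_holds`): coordinates of holomorphic cotangent forms are smooth in the archimedean variable along `cmArchSection`. (print: BorelJacquet1979 §4.2; HarishChandraTAMS1953 §7) -/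
def L2bHolArchSmoothType : Prop :=
  ∀ (L : Type) [Field L] [NumberField L] [IsCMField L] (ι : L →+* ℂ) (H : Matrix (Fin 3) (Fin 3) L) (T : GL (Fin 3) ℂ)
    (hT : (T : Matrix (Fin 3) (Fin 3) ℂ)ᴴ * H.map ι * (T : Matrix (Fin 3) (Fin 3) ℂ) = Literature.Geometry.ComplexHyperbolic.BallModel.J),
    ∀ Φ ∈ holCotForms (↥(maximalRealSubfield L)) L (IsCMField.complexConj L) 3 H (cmArchSection L ι H T hT) (cmCompactFactor L ι H T hT),
    ∀ j : Fin 2, IsArchSmooth (H := u21Group) (cmArchSection L ι H T hT) (fun x => Φ x j)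

/-- L2B-ii — SLICE CONTINUITY (F0P2a-p03; closer ★ `F0P2aL2bSliceContinuous.sig_L2Bii_holds`): a slice-continuous, `K_c`-invariant, `K_f`-invariant function on `U(H)(𝔸)` is continuous. (print: BorelJacquet1979 §4.2) -/
def L2bSliceContinuousType : Prop :=
  ∀ (L : Type) [Field L] [NumberField L] [IsCMField L] (ι : L →+* ℂ) (H : Matrix (Fin 3) (Fin 3) L) (T : GL (Fin 3) ℂ)
    (hT : (T : Matrix (Fin 3) (Fin 3) ℂ)ᴴ * H.map ι * (T : Matrix (Fin 3) (Fin 3) ℂ) = Literature.Geometry.ComplexHyperbolic.BallModel.J),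
    (∀ τ' : L →+* ℂ, InfinitePlace.mk τ' ≠ InfinitePlace.mk ι → (H.map τ').PosDef) →
    ∀ ψ : (adelicGroupData (↥(maximalRealSubfield L)) L (IsCMField.complexConj L) 3 H).Adelic → ℂ,
    (∀ x, Continuous fun u : ↥U21 => ψ (x * cmArchSection L ι H T hT u)) →
    (∀ k ∈ cmCompactFactor L ι H T hT, ∀ x, ψ (x * k) = ψ x) →
    (∃ Kf : Subgroup (finAdelic (↥(maximalRealSubfield L)) L (IsCMField.complexConj L) 3 H),
    IsOpen (Kf : Set (finAdelic (↥(maximalRealSubfield L)) L (IsCMField.complexConj L) 3 H)) ∧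
    ∀ k ∈ Kf, ∀ x, ψ (x * finAdelicToAdelic (↥(maximalRealSubfield L)) L (IsCMField.complexConj L) 3 H k) = ψ x) →
    Continuous ψ

/-- L2C — ORDERED PRODUCTS + `h₀`-WEIGHTS (engine ★ p796527 `F0P2aL2cPNullSpanOrthogonal`, A-p08 (g15); consumer `F0P2aL2cOrderedProducts.sig_L2C_holds`, F0P2a-p08): inside an `L²`-Lie-stable space of smooth functions (F3 frame, universe 0), the `𝔤`-span of a finite-dimensional `𝔨`-stable `𝔭⁻`-null `h₀`-eigen `V` sits in a Lie-stable `S ≤ W` orthogonal to any `h₀`-eigenvector `ψ₃` (same eigenvalue) orthogonal to `V`. (print: BorelWallach2000 II §4.1, VII 2.10; Knapp1986 VIII §7) -/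
def L2cOrderedProductsType : Prop :=
  ∀ {K : Type} [Field K] [NumberField K] (𝒢 : AdelicGroupData.{0} K) (ι : ↥U21 →* 𝒢.Adelic), Continuous ι →
    ∀ (μ : Measure 𝒢.automorphicQuotient) [𝒢.IsAutomorphicMeasure μ] (W : Submodule ℂ (𝒢.Adelic → ℂ)),
    (∀ φ ∈ W, IsArchSmooth (H := u21Group) ι φ) →
    (∀ (X : u21Group.lie), ∀ φ ∈ W, lieDeriv (H := u21Group) ι X φ ∈ W) →
    W ≤ 𝒢.l2Representable μ →
    ∀ (h₀ : u21Group.lie), (h₀ : Matrix (Fin 3) (Fin 3) ℂ) = Complex.I • Literature.Geometry.ComplexHyperbolic.BallModel.J →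
    ∀ (c : ℂ) (V : Submodule ℂ (𝒢.Adelic → ℂ)), V ≤ W → FiniteDimensional ℂ V →
    (∀ Y : u21Group.lie, (Y : Matrix (Fin 3) (Fin 3) ℂ) * Literature.Geometry.ComplexHyperbolic.BallModel.J =
    Literature.Geometry.ComplexHyperbolic.BallModel.J * (Y : Matrix (Fin 3) (Fin 3) ℂ) →
    ∀ φ ∈ V, lieDeriv (H := u21Group) ι Y φ ∈ V) →
    (∀ (b : Fin 2 → ℂ), ∀ φ ∈ V, lieDeriv (H := u21Group) ι (liePMat (Complex.I • b)) φ =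
    Complex.I • lieDeriv (H := u21Group) ι (liePMat b) φ) →
    (∀ φ ∈ V, lieDeriv (H := u21Group) ι h₀ φ = c • φ) →
    ∀ ψ₃ ∈ W, lieDeriv (H := u21Group) ι h₀ ψ₃ = c • ψ₃ →
    ∀ (f₃ : 𝒢.automorphicQuotient → ℂ) (hf₃ : MemLp f₃ 2 μ), invQuot 𝒢 f₃ = ψ₃ →
    (∀ φ ∈ V, ∀ (f : 𝒢.automorphicQuotient → ℂ) (hf : MemLp f 2 μ), invQuot 𝒢 f = φ → ⟪hf.toLp f, hf₃.toLp f₃⟫_ℂ = 0) →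
    ∃ S : Submodule ℂ (𝒢.Adelic → ℂ), V ≤ S ∧ S ≤ W ∧
    (∀ (X : u21Group.lie), ∀ φ ∈ S, lieDeriv (H := u21Group) ι X φ ∈ S) ∧
    (∀ φ ∈ S, ∀ (f : 𝒢.automorphicQuotient → ℂ) (hf : MemLp f 2 μ), invQuot 𝒢 f = φ → ⟪hf.toLp f, hf₃.toLp f₃⟫_ℂ = 0)

/-- L2D — NELSON / HARISH-CHANDRA ANALYTICITY (F0P2a-p02; = ★ p796713 Literature `analyticAt_inner_rightRegular_toLp_of_u21_null_of_mem_lieSpan`, universally closed at universe 0): matrix coefficients of every element of the `𝔤`-span of a finite-dimensional `𝔨`-stable `𝔭⁻`-null `V` are real-analytic along one-parameter subgroups. (print: Nelson1959 §8; HarishChandraTAMS1953 Lemma 34) -/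
def L2dAnalyticVectorsType : Prop :=
  ∀ {K : Type} [Field K] [NumberField K] {𝒢 : AdelicGroupData.{0} K}
    {μ : Measure 𝒢.automorphicQuotient} [𝒢.IsAutomorphicMeasure μ] (ι : ↥U21 →* 𝒢.Adelic), Continuous ι →
    ∀ {W : Submodule ℂ (𝒢.Adelic → ℂ)},
    (∀ φ ∈ W, IsArchSmooth (H := u21Group) ι φ) →
    (∀ X : u21Group.lie, ∀ φ ∈ W, lieDeriv (H := u21Group) ι X φ ∈ W) →
    ∀ (hrep : W ≤ 𝒢.l2Representable μ),
    (∀ (φ : 𝒢.Adelic → ℂ) (hφ : φ ∈ W), 𝒢.l2ClassOf μ ⟨φ, hrep hφ⟩ = 0 → φ = 0) →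
    ∀ (V : Submodule ℂ (𝒢.Adelic → ℂ)) [FiniteDimensional ℂ V], V ≤ W →
    (∀ Y : u21Group.lie, (Y : Matrix (Fin 3) (Fin 3) ℂ) ∈ u21Group.compactLie →
    ∀ ψ ∈ V, lieDeriv (H := u21Group) ι Y ψ ∈ V) →
    ∀ (c : ℂ), c * c = -1 →
    (∀ ψ ∈ V, ∀ b : Fin 2 → ℂ,
    lieDeriv (H := u21Group) ι (liePMat (Complex.I • b)) ψ = c • lieDeriv (H := u21Group) ι (liePMat b) ψ) →
    ∀ {φ : 𝒢.Adelic → ℂ},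
    φ ∈ Submodule.span ℂ {χ | ∃ (l : List u21Group.lie) (ψ : 𝒢.Adelic → ℂ), ψ ∈ V ∧ χ = iterLieDeriv (H := u21Group) ι l ψ} →
    ∀ {f : 𝒢.automorphicQuotient → ℂ} (hf : MemLp f 2 μ), invQuot 𝒢 f = φ →
    ∀ (X : u21Group.lie) (u : 𝒢.L2 μ) (t₀ : ℝ),
    AnalyticAt ℝ (fun t : ℝ => ⟪u, 𝒢.rightRegular μ (ι (u21Group.expMem (t • X))) (hf.toLp f)⟫_ℂ) t₀

/-- L2E-i — EXPONENTIAL GENERATION (lead F0P2a-p01; closer ★ `F0P2aL2eExpGeneration.subgroup_eq_top_of_forall_expMem_mem`): a subgroup of `U(2,1)` containing `exp 𝔲(2,1)` is everything. (print: Knapp2002 I.§10, VI.§2) -/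
def L2eExpGenerationType : Prop :=
  ∀ S : Subgroup ↥U21, (∀ X : u21Group.lie, (u21Group.expMem X : ↥U21) ∈ S) → S = ⊤

end L2Cuts

/-! ## §2 The registered stubs -/

/-- S1 — FOLDED since ed. 2 onto ★ p795696 `Theorems/F0P2aStubS1SesqSchur.lean` (F0P2a-p04; statement unchanged).
[cite: BernsteinZelevinsky1976, §2] [cite: Bump1997, Proposition 4.2.4] -/
theorem stub_sesqSchur : SesqSchurType :=
  Summit.HodgeConjecture.HodgeConjecture.Cruxes.H413.F0P2aStubS1SesqSchur.stubS1_holds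

/-- L2A — FOLDED at registration (ed. 4) onto ★ p796687 `Theorems/F0P2aL2aKSchur.lean` (F0P2a-p04). [cite: Knapp1986, Prop. 8.5] -/
theorem stub_L2a : L2aKSchurType :=
  Summit.HodgeConjecture.HodgeConjecture.Cruxes.H413.F0P2aL2aKSchur.l2a_holds

/-- L2B-i — FOLDED at registration (ed. 4) onto ★ `Theorems/F0P2aL2bHolArchSmooth.lean` (F0P2a-p03). [cite: BorelJacquet1979, §4.2] -/
theorem stub_L2bi : L2bHolArchSmoothType :=
  Summit.HodgeConjecture.HodgeConjecture.Cruxes.H413.F0P2aL2bHolArchSmooth.sig_L2Bi_holds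

/-- L2B-ii — FOLDED at registration (ed. 4) onto ★ `Theorems/F0P2aL2bSliceContinuous.lean` (F0P2a-p03). [cite: BorelJacquet1979, §4.2] -/
theorem stub_L2bii : L2bSliceContinuousType :=
  Summit.HodgeConjecture.HodgeConjecture.Cruxes.H413.F0P2aL2bSliceContinuous.sig_L2Bii_holds

/-- L2C — FOLDED at registration (ed. 4) onto ★ p797086 `Theorems/F0P2aL2cOrderedProducts.lean` (F0P2a-p08 over A-p08's ★ engine p796527
`F0P2aL2cPNullSpanOrthogonal`). [cite: BorelWallach2000, II §4.1] [cite: Knapp1986, VIII §7] -/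
theorem stub_L2c : L2cOrderedProductsType :=
  Summit.HodgeConjecture.HodgeConjecture.Cruxes.H413.F0P2aL2cOrderedProducts.sig_L2C_holds

/-- L2D — FOLDED at registration (ed. 4) onto ★ p797110 `Theorems/F0P2aStubL2dNelson.lean` (F0P2a-p02; = ★ p796713
`Literature/NumberTheory/Automorphic/U21AnalyticVectors.lean` closed at universe 0). [cite: Nelson1959, §8] [cite: HarishChandraTAMS1953, Lemma 34] -/
theorem stub_L2d : L2dAnalyticVectorsType :=
  Summit.HodgeConjecture.HodgeConjecture.Cruxes.H413.F0P2aStubL2dNelson.stub_L2d_holds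

/-- L2E-i — FOLDED at registration (ed. 4) onto ★ `Theorems/F0P2aL2eExpGeneration.lean` (lead F0P2a-p01): `U(2,1)` is generated by `exp 𝔲(2,1)`
(connectedness of `U(2,1)` + open-subgroup argument). [cite: Knapp2002, I.§10] -/
theorem stub_L2e : L2eExpGenerationType :=
  Summit.HodgeConjecture.HodgeConjecture.Cruxes.H413.F0P2aL2eExpGeneration.subgroup_eq_top_of_forall_expMem_mem

/-- S2⁺ (L; HARDEST) — FOLDED at registration (ed. 4) onto the lead's ★ composition `Theorems/F0P2aArchOrthHolOfCuts.lean ::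
F0P2aArchOrthHol.archOrthHol_of_cuts` applied to the six registered sub-stubs `stub_L2a stub_L2bi stub_L2bii stub_L2c stub_L2d stub_L2e` (§1b; all ★-folded).
[cite: HarishChandraTAMS1953, Cor. to Thm 2; Lemma 34] [cite: BorelWallach2000, VII 3.2] [cite: Liu2021, Lem. D.2 (2)] -/
theorem stub_archOrth_hol : ArchOrthHolType :=
  Summit.HodgeConjecture.HodgeConjecture.Cruxes.H413.F0P2aArchOrthHol.archOrthHol_of_cuts
    stub_L2a stub_L2bi stub_L2bii stub_L2c stub_L2d stub_L2e

/-- S2⁻ — DERIVED since ed. 2 from S2⁺ by complex conjugation on `L²` (★ p795253, F0P2a-p06; statement unchanged).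
[cite: BorelWallach2000, VII 2.10] -/
theorem stub_archOrth_antihol : ArchOrthAntiholType :=
  Summit.HodgeConjecture.HodgeConjecture.Cruxes.H413.F0P2aArchOrthAntihol.archOrth_antihol_of_hol stub_archOrth_hol

/-- S2β — FOLDED since ed. 3 onto ★ p795563 `Theorems/F0P2aStubDensity.densityType_of_continuous` (F0P2a-p05) applied to ★ p796556
`Theorems/F0P2aCohFormsContinuous.continuous_of_mem_cohForms_frame` (B5, F0P2a-p03); statement unchanged. [cite: BorelJacquet1979, §4.6] -/
theorem stub_density : DensityType :=
  Summit.HodgeConjecture.HodgeConjecture.Cruxes.H413.F0P2aStubDensity.densityType_of_continuous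
    Summit.HodgeConjecture.HodgeConjecture.Cruxes.H413.F0P2aCohFormsContinuous.continuous_of_mem_cohForms_frame

/-- S3 — FOLDED since ed. 3 onto ★ p796549 `Theorems/F0P2aStubAdmissibleOfCohValued.lean` (F0P2a-p07, via ★ `F0P2aCohFormsFixedFinite` +
★ `F0P2aFrameTransport`, F0P2a-p06; statement unchanged). [cite: BorelWallach2000, VII 3.2] -/
theorem stub_admissible_of_cohValued : AdmissibleOfCohValuedType :=
  Summit.HodgeConjecture.HodgeConjecture.Cruxes.H413.F0P2aStubAdmissibleOfCohValued.stubS3_holds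


/-! ## §3 Generic plumbing over any unitary datum `(F, E, c, N, J)`: `ContainsForm` algebra, coordinate class maps, unitarity -/

section Generic

variable {F E : Type} [Field F] [NumberField F] [Field E] [NumberField E] [Algebra F E]
  {c : E ≃ₐ[F] E} {N : ℕ} {J : Matrix (Fin N) (Fin N) E}
  {μ : Measure (adelicGroupData F E c N J).automorphicQuotient}
  [(adelicGroupData F E c N J).IsAutomorphicMeasure μ]

/-- `⟪R(x) u, R(x) v⟫ = ⟪u, v⟫`: the regular representation preserves inner products (it is norm-preserving, ★
`AdelicGroupData.norm_rightRegular_apply`; Mathlib `LinearIsometry.inner_map_map`). [cite: BorelJacquet1979, §4.6] -/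
theorem inner_rightRegular_rightRegular (x : (adelicGroupData F E c N J).Adelic) (u v : (adelicGroupData F E c N J).L2 μ) :
    ⟪(adelicGroupData F E c N J).rightRegular μ x u, (adelicGroupData F E c N J).rightRegular μ x v⟫_ℂ = ⟪u, v⟫_ℂ :=
  let T : (adelicGroupData F E c N J).L2 μ →ₗᵢ[ℂ] (adelicGroupData F E c N J).L2 μ :=
    { toLinearMap := ((adelicGroupData F E c N J).rightRegular μ x :
          (adelicGroupData F E c N J).L2 μ →L[ℂ] (adelicGroupData F E c N J).L2 μ).toLinearMap
      norm_map' := (adelicGroupData F E c N J).norm_rightRegular_apply μ x }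
  T.inner_map_map u v

/-- `P.ContainsForm` is stable under `Φ ↦ Φ - r • Ψ` (the classes of `P` form a submodule of `L²`). [cite: BorelJacquet1979, §4.6] -/
theorem containsForm_sub_smul (P : DiscreteAutomorphicRep (adelicGroupData F E c N J) μ)
    {Φ Ψ : (adelicGroupData F E c N J).Adelic → (Fin 2 → ℂ)} (hΦ : P.ContainsForm Φ) (hΨ : P.ContainsForm Ψ) (r : ℂ) :
    P.ContainsForm (Φ - r • Ψ) := by
  intro j
  obtain ⟨h1, h1P⟩ := hΦ j
  obtain ⟨h2, h2P⟩ := hΨ j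
  have hfun : (toQuotFun (adelicGroupData F E c N J) fun x => (Φ - r • Ψ) x j) =
      (toQuotFun (adelicGroupData F E c N J) fun x => Φ x j) - r • (toQuotFun (adelicGroupData F E c N J) fun x => Ψ x j) := by
    funext y
    simp only [toQuotFun, Pi.sub_apply, Pi.smul_apply, smul_eq_mul]
  have hmem : MemLp (toQuotFun (adelicGroupData F E c N J) fun x => (Φ - r • Ψ) x j) 2 μ := by
    rw [hfun]
    exact h1.sub (h2.const_smul r)
  refine ⟨hmem, ?_⟩
  have heq : hmem.toLp (toQuotFun (adelicGroupData F E c N J) fun x => (Φ - r • Ψ) x j) =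
      h1.toLp (toQuotFun (adelicGroupData F E c N J) fun x => Φ x j) -
        r • h2.toLp (toQuotFun (adelicGroupData F E c N J) fun x => Ψ x j) := by
    rw [← MemLp.toLp_const_smul, ← MemLp.toLp_sub]
    exact MemLp.toLp_congr _ _ (Filter.EventuallyEq.of_eq hfun)
  rw [heq]
  exact P.space.toSubmodule.sub_mem h1P (P.space.toSubmodule.smul_mem r h2P)

/-- **Coordinate class maps.**  For a `σ`-equivariant linear `φ : W → (U(J)(𝔸) → ℂ²)` with left-invariant values contained in `P`, the two
maps `Λ j : w ↦ [toQuotFun (φ w · j)] ∈ L²` are LINEAR, valued in `P`, and intertwine `σ` with `R|_{U(J)(𝔸_f)}` (★ `toLp_toQuotFun_mul_right`);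
the `MemLp` proof inside `toLp` is irrelevant.  (Pattern of ★ `SpectrumJunction.hasFinComponent_of_equivariant`.) [cite: BorelJacquet1979, §4.6] -/
theorem exists_clsMaps (P : DiscreteAutomorphicRep (adelicGroupData F E c N J) μ)
    {W : Type} [AddCommGroup W] [Module ℂ W] (σ : Representation ℂ (finAdelic F E c N J) W)
    (φ : W →ₗ[ℂ] ((adelicGroupData F E c N J).Adelic → (Fin 2 → ℂ)))
    (hE : ∀ (g : finAdelic F E c N J) (w : W), φ (σ g w) = CotangentForms.rightRep F E c N J g (φ w))
    (hleft : ∀ w, ∀ γ ∈ (adelicGroupData F E c N J).quotientSubgroup, ∀ x, φ w (γ * x) = φ w x)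
    (hP : ∀ w, P.ContainsForm (φ w)) :
    ∃ Λ : Fin 2 → (W →ₗ[ℂ] (adelicGroupData F E c N J).L2 μ),
      (∀ (j : Fin 2) (w : W) (h : MemLp (toQuotFun (adelicGroupData F E c N J) fun x => φ w x j) 2 μ),
          Λ j w = h.toLp (toQuotFun (adelicGroupData F E c N J) fun x => φ w x j)) ∧
      (∀ (j : Fin 2) (w : W), Λ j w ∈ P.space.toSubmodule) ∧
      (∀ (j : Fin 2) (g : finAdelic F E c N J) (w : W),
          Λ j (σ g w) = (adelicGroupData F E c N J).rightRegular μ (finAdelicToAdelic F E c N J g) (Λ j w)) := by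
  have hmem : ∀ (w : W) (j : Fin 2), MemLp (toQuotFun (adelicGroupData F E c N J) fun x => φ w x j) 2 μ :=
    fun w j => ((hP w) j).choose
  have hmemP : ∀ (w : W) (j : Fin 2),
      (hmem w j).toLp (toQuotFun (adelicGroupData F E c N J) fun x => φ w x j) ∈ P.space.toSubmodule :=
    fun w j => ((hP w) j).choose_spec
  have hleftj : ∀ (w : W) (j : Fin 2), ∀ γ ∈ (adelicGroupData F E c N J).quotientSubgroup, ∀ x,
      (fun x => φ w x j) (γ * x) = (fun x => φ w x j) x :=
    fun w j γ hγ x => by simp only [hleft w γ hγ x]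
  let Λ : Fin 2 → (W →ₗ[ℂ] (adelicGroupData F E c N J).L2 μ) := fun j =>
    { toFun := fun w => (hmem w j).toLp (toQuotFun (adelicGroupData F E c N J) fun x => φ w x j)
      map_add' := fun w w' => by
        change (hmem (w + w') j).toLp _ = (hmem w j).toLp _ + (hmem w' j).toLp _
        rw [← MemLp.toLp_add]
        exact MemLp.toLp_congr _ _ (Filter.EventuallyEq.of_eq
          (funext fun y => by simp only [toQuotFun, map_add, Pi.add_apply]))
      map_smul' := fun r w => by
        change (hmem (r • w) j).toLp _ = r • (hmem w j).toLp _
        rw [← MemLp.toLp_const_smul]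
        exact MemLp.toLp_congr _ _ (Filter.EventuallyEq.of_eq
          (funext fun y => by simp only [toQuotFun, map_smul, Pi.smul_apply, smul_eq_mul])) }
  have hΛ : ∀ (j : Fin 2) (w : W),
      Λ j w = (hmem w j).toLp (toQuotFun (adelicGroupData F E c N J) fun x => φ w x j) := fun _ _ => rfl
  refine ⟨Λ, fun j w h => hΛ j w, fun j w => by rw [hΛ]; exact hmemP w j, fun j g w => ?_⟩
  rw [hΛ, hΛ]
  have hfun : (toQuotFun (adelicGroupData F E c N J) fun x => φ (σ g w) x j) =
      toQuotFun (adelicGroupData F E c N J) fun x => (fun y => φ w y j) (x * finAdelicToAdelic F E c N J g) := by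
    funext y
    simp only [toQuotFun, hE, CotangentForms.rightRep_apply]
  have hmemh : MemLp (toQuotFun (adelicGroupData F E c N J)
      fun x => (fun y => φ w y j) (x * finAdelicToAdelic F E c N J g)) 2 μ := hfun ▸ hmem (σ g w) j
  rw [show (hmem (σ g w) j).toLp _ = hmemh.toLp _ from MemLp.toLp_congr _ _ (Filter.EventuallyEq.of_eq hfun)]
  exact toLp_toQuotFun_mul_right (hleftj w j) _ (hmem w j) hmemh

/-- **`OrthVanish A P`** — the orthogonality-vanishing property of a space of forms `A` relative to `P`: a form `Φ₃ ∈ A` contained in `P`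
whose coordinate classes are TRACE-orthogonal to those of every member of a non-zero `U(J)(𝔸_f)`-stable family `N ≤ A` of forms contained
in `P` is zero.  (For `A` = holomorphic, resp. antiholomorphic, cotangent forms of the CM factor it follows from S2⁺, resp. S2⁻, and S2β:
`orthVanish_hol`, `orthVanish_antihol`.) (print: BorelWallach2000, VII 3.2) (print: HarishChandraTAMS1953, Cor. to Thm 2) -/
def OrthVanish (A : Submodule ℂ ((adelicGroupData F E c N J).Adelic → (Fin 2 → ℂ)))
    (P : DiscreteAutomorphicRep (adelicGroupData F E c N J) μ) : Prop :=
  ∀ N' : Submodule ℂ ((adelicGroupData F E c N J).Adelic → (Fin 2 → ℂ)), N' ≤ A →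
    (∀ Φ ∈ N', P.ContainsForm Φ) → (∀ (g : finAdelic F E c N J), ∀ Φ ∈ N', CotangentForms.rightRep F E c N J g Φ ∈ N') → N' ≠ ⊥ →
    ∀ Φ₃ ∈ A, P.ContainsForm Φ₃ →
    (∀ Φ ∈ N', ∀ (hΦ : ∀ j : Fin 2, MemLp (toQuotFun (adelicGroupData F E c N J) fun x => Φ x j) 2 μ)
        (h₃ : ∀ j : Fin 2, MemLp (toQuotFun (adelicGroupData F E c N J) fun x => Φ₃ x j) 2 μ),
      ∑ j : Fin 2, ⟪(hΦ j).toLp (toQuotFun (adelicGroupData F E c N J) fun x => Φ x j),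
        (h₃ j).toLp (toQuotFun (adelicGroupData F E c N J) fun x => Φ₃ x j)⟫_ℂ = 0) →
    Φ₃ = 0

/-- **THE BOOTSTRAP (generic).**  `SesqSchurType` + `OrthVanish A P` ⇒ for `σ` irreducible admissible, any two `σ`-equivariant linear maps
`ψ₁ ≠ 0`, `ψ` with values in `{Φ ∈ A ∣ P.ContainsForm Φ}` are proportional: `ψ = r • ψ₁`.  Steps (1)(2)(3) of the module docstring, then
`OrthVanish` applied to `N := range ψ₁` and `Φ₃ := (ψ - c • ψ₁) w'`. [cite: Liu2021, Lem. D.2 (2)] [cite: BorelWallach2000, VII 3.2] -/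
theorem exists_eq_smul_of_orthVanish (hS : SesqSchurType) (P : DiscreteAutomorphicRep (adelicGroupData F E c N J) μ)
    (A : Submodule ℂ ((adelicGroupData F E c N J).Adelic → (Fin 2 → ℂ)))
    (hAleft : ∀ Φ ∈ A, ∀ γ ∈ (adelicGroupData F E c N J).quotientSubgroup, ∀ x, Φ (γ * x) = Φ x)
    (hA : OrthVanish A P)
    {W : Type} [AddCommGroup W] [Module ℂ W] (σ : Representation ℂ (finAdelic F E c N J) W)
    (hirr : σ.IsIrreducible) (hadm : σ.IsAdmissible)
    (ψ₁ ψ : W →ₗ[ℂ] ((adelicGroupData F E c N J).Adelic → (Fin 2 → ℂ)))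
    (hE₁ : ∀ (g : finAdelic F E c N J) (w : W), ψ₁ (σ g w) = CotangentForms.rightRep F E c N J g (ψ₁ w))
    (hV₁ : ∀ w, ψ₁ w ∈ A ∧ P.ContainsForm (ψ₁ w)) (hne : ψ₁ ≠ 0)
    (hE : ∀ (g : finAdelic F E c N J) (w : W), ψ (σ g w) = CotangentForms.rightRep F E c N J g (ψ w))
    (hV : ∀ w, ψ w ∈ A ∧ P.ContainsForm (ψ w)) :
    ∃ r : ℂ, ψ = r • ψ₁ := by
  obtain ⟨Λ₁, hΛ₁, -, hΛ₁e⟩ := exists_clsMaps P σ ψ₁ hE₁ (fun w => hAleft _ (hV₁ w).1) (fun w => (hV₁ w).2)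
  obtain ⟨Λ, hΛ, -, hΛe⟩ := exists_clsMaps P σ ψ hE (fun w => hAleft _ (hV w).1) (fun w => (hV w).2)
  -- (1) the maps into the Hilbert sum `L² ⊕ L²`
  let φ₁ : W →ₗ[ℂ] PiLp 2 (fun _ : Fin 2 => (adelicGroupData F E c N J).L2 μ) :=
    (WithLp.linearEquiv 2 ℂ (Fin 2 → (adelicGroupData F E c N J).L2 μ)).symm.toLinearMap ∘ₗ LinearMap.pi fun j => Λ₁ j
  let φ₂ : W →ₗ[ℂ] PiLp 2 (fun _ : Fin 2 => (adelicGroupData F E c N J).L2 μ) :=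
    (WithLp.linearEquiv 2 ℂ (Fin 2 → (adelicGroupData F E c N J).L2 μ)).symm.toLinearMap ∘ₗ LinearMap.pi fun j => Λ j
  have hφ₁ : ∀ (w : W) (j : Fin 2), φ₁ w j = Λ₁ j w := fun _ _ => rfl
  have hφ₂ : ∀ (w : W) (j : Fin 2), φ₂ w j = Λ j w := fun _ _ => rfl
  have hin : ∀ x y : PiLp 2 (fun _ : Fin 2 => (adelicGroupData F E c N J).L2 μ), ⟪x, y⟫_ℂ = ∑ j, ⟪x j, y j⟫_ℂ :=
    fun x y => PiLp.inner_apply x y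
  have hb₁ : ∀ (g : finAdelic F E c N J) (w w' : W), ⟪φ₁ (σ g w), φ₁ (σ g w')⟫_ℂ = ⟪φ₁ w, φ₁ w'⟫_ℂ := by
    intro g w w'
    rw [hin, hin]
    refine Finset.sum_congr rfl fun j _ => ?_
    rw [hφ₁, hφ₁, hφ₁, hφ₁, hΛ₁e, hΛ₁e, inner_rightRegular_rightRegular]
  have hb₂ : ∀ (g : finAdelic F E c N J) (w w' : W), ⟪φ₁ (σ g w), φ₂ (σ g w')⟫_ℂ = ⟪φ₁ w, φ₂ w'⟫_ℂ := by
    intro g w w'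
    rw [hin, hin]
    refine Finset.sum_congr rfl fun j _ => ?_
    rw [hφ₁, hφ₁, hφ₂, hφ₂, hΛ₁e, hΛe, inner_rightRegular_rightRegular]
  -- a compact open subgroup of `U(J)(𝔸_f)`: the integral congruence level
  have hK : ∃ K₀ : OpenSubgroup (finAdelic F E c N J), IsCompact (K₀ : Set (finAdelic F E c N J)) :=
    ⟨⟨finCongruenceLevel F E c N J ⊤, (isCompact_isOpen_finCongruenceLevel_top F E c N J).2⟩,
      (isCompact_isOpen_finCongruenceLevel_top F E c N J).1⟩
  -- (2) Schur for invariant sesquilinear forms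
  obtain ⟨c₀, hc₀⟩ := hS (finAdelic F E c N J) W σ hirr hadm hK _ φ₁ φ₂ hb₁ hb₂
  -- (3) the corrected map `ψ - c₀ • ψ₁`
  have hE₃ : ∀ (g : finAdelic F E c N J) (w : W), (ψ - c₀ • ψ₁) (σ g w) = CotangentForms.rightRep F E c N J g ((ψ - c₀ • ψ₁) w) := by
    intro g w
    simp only [LinearMap.sub_apply, LinearMap.smul_apply, hE, hE₁, map_sub, map_smul]
  have hV₃ : ∀ w, (ψ - c₀ • ψ₁) w ∈ A ∧ P.ContainsForm ((ψ - c₀ • ψ₁) w) := fun w =>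
    ⟨A.sub_mem (hV w).1 (A.smul_mem c₀ (hV₁ w).1), by
      simpa only [LinearMap.sub_apply, LinearMap.smul_apply] using containsForm_sub_smul P (hV w).2 (hV₁ w).2 c₀⟩
  obtain ⟨Λ₃, hΛ₃, -, -⟩ := exists_clsMaps P σ (ψ - c₀ • ψ₁) hE₃ (fun w => hAleft _ (hV₃ w).1) (fun w => (hV₃ w).2)
  have hΛ₃eq : ∀ (j : Fin 2) (w' : W), Λ₃ j w' = Λ j w' - c₀ • Λ₁ j w' := by
    intro j w'
    have h1 : MemLp (toQuotFun (adelicGroupData F E c N J) fun x => ψ w' x j) 2 μ := ((hV w').2 j).choose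
    have h2 : MemLp (toQuotFun (adelicGroupData F E c N J) fun x => ψ₁ w' x j) 2 μ := ((hV₁ w').2 j).choose
    have hfun : (toQuotFun (adelicGroupData F E c N J) fun x => (ψ - c₀ • ψ₁) w' x j) =
        (toQuotFun (adelicGroupData F E c N J) fun x => ψ w' x j) -
          c₀ • (toQuotFun (adelicGroupData F E c N J) fun x => ψ₁ w' x j) := by
      funext y
      simp only [toQuotFun, LinearMap.sub_apply, LinearMap.smul_apply, Pi.sub_apply, Pi.smul_apply, smul_eq_mul]
    have h3 : MemLp (toQuotFun (adelicGroupData F E c N J) fun x => (ψ - c₀ • ψ₁) w' x j) 2 μ := by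
      rw [hfun]
      exact h1.sub (h2.const_smul c₀)
    rw [hΛ₃ j w' h3, hΛ j w' h1, hΛ₁ j w' h2, ← MemLp.toLp_const_smul, ← MemLp.toLp_sub]
    exact MemLp.toLp_congr _ _ (Filter.EventuallyEq.of_eq hfun)
  have horth : ∀ w w' : W, ∑ j : Fin 2, ⟪Λ₁ j w, Λ₃ j w'⟫_ℂ = 0 := by
    intro w w'
    have h := hc₀ w w'
    rw [hin, hin, Finset.mul_sum] at h
    rw [← sub_eq_zero, ← Finset.sum_sub_distrib] at h
    rw [← h]
    refine Finset.sum_congr rfl fun j _ => ?_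
    simp only [hφ₁, hφ₂, hΛ₃eq, inner_sub_right, inner_smul_right]
  -- (4)+(5) `OrthVanish` on `N := range ψ₁`, `Φ₃ := (ψ - c₀ • ψ₁) w'`
  have hzero : ∀ w' : W, (ψ - c₀ • ψ₁) w' = 0 := by
    intro w'
    refine hA (LinearMap.range ψ₁) ?_ ?_ ?_ ?_ ((ψ - c₀ • ψ₁) w') (hV₃ w').1 (hV₃ w').2 ?_
    · rintro _ ⟨w, rfl⟩
      exact (hV₁ w).1
    · rintro _ ⟨w, rfl⟩
      exact (hV₁ w).2
    · rintro g _ ⟨w, rfl⟩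
      exact LinearMap.mem_range.mpr ⟨σ g w, hE₁ g w⟩
    · intro h0
      exact hne (LinearMap.range_eq_bot.mp h0)
    · rintro _ ⟨w, rfl⟩ hΦ h₃
      calc ∑ j : Fin 2, ⟪(hΦ j).toLp (toQuotFun (adelicGroupData F E c N J) fun x => ψ₁ w x j),
              (h₃ j).toLp (toQuotFun (adelicGroupData F E c N J) fun x => (ψ - c₀ • ψ₁) w' x j)⟫_ℂ
            = ∑ j : Fin 2, ⟪Λ₁ j w, Λ₃ j w'⟫_ℂ :=
              Finset.sum_congr rfl fun j _ => by rw [← hΛ₁ j w (hΦ j), ← hΛ₃ j w' (h₃ j)]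
        _ = 0 := horth w w'
  have hψ : ψ - c₀ • ψ₁ = 0 := LinearMap.ext hzero
  exact ⟨c₀, sub_eq_zero.mp hψ⟩

end Generic

/-! ## §4 The CM factor: `OrthVanish` for `hol` and `antihol` from S2⁺ / S2⁻ and S2β -/

section CM

variable (L : Type) [Field L] [NumberField L] [IsCMField L] (ι : L →+* ℂ) (H : Matrix (Fin 3) (Fin 3) L) (T : GL (Fin 3) ℂ)
  (hT : (T : Matrix (Fin 3) (Fin 3) ℂ)ᴴ * H.map ι * (T : Matrix (Fin 3) (Fin 3) ℂ) = Literature.Geometry.ComplexHyperbolic.BallModel.J)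

/-- `antihol ≤ coh` (`cohForms = hol ⊔ hol.map conjFun`). [cite: BorelWallach2000, VII 2.10] -/
theorem antihol_le_coh : antihol L ι H T hT ≤ coh L ι H T hT := fun Φ hΦ => by
  change Φ ∈ CotangentForms.cohForms _ _ _ _ _ _ _
  unfold CotangentForms.cohForms
  exact Submodule.mem_sup_right hΦ

/-- Antiholomorphic cotangent forms are left-`U(H)(L⁺)`-invariant. [cite: BorelJacquet1979, §4.2] -/
theorem leftInvariant_of_mem_antihol {Φ : (𝒰 L H).Adelic → (Fin 2 → ℂ)} (hΦ : Φ ∈ antihol L ι H T hT) :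
    ∀ γ ∈ (𝒰 L H).quotientSubgroup, ∀ x, Φ (γ * x) = Φ x :=
  leftInvariant_of_mem_cohForms (antihol_le_coh L ι H T hT hΦ)

variable {L ι H T hT}

/-- `OrthVanish (hol) P` from S2⁺ and S2β. [cite: BorelWallach2000, VII 3.2] [cite: HarishChandraTAMS1953, Cor. to Thm 2] -/
theorem orthVanish_hol (hα : ArchOrthHolType) (hβ : DensityType)
    (hdef : ∀ τ' : L →+* ℂ, InfinitePlace.mk τ' ≠ InfinitePlace.mk ι → (H.map τ').PosDef)
    (h2 : 2 ≤ Module.finrank ℚ ↥(maximalRealSubfield L))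
    (μ : Measure (𝒰 L H).automorphicQuotient) [(𝒰 L H).IsAutomorphicMeasure μ] (P : DiscreteAutomorphicRep (𝒰 L H) μ) :
    OrthVanish (hol L ι H T hT) P := by
  intro N' hNA hNP hNst hN0 Φ₃ hΦ₃ hP₃ horth
  exact hβ L ι H T hT hdef h2 μ P N' (fun Φ hΦ => CotangentForms.holCotForms_le_cohForms (hNA hΦ)) hNP hNst hN0 Φ₃
    (CotangentForms.holCotForms_le_cohForms hΦ₃) hP₃
    (fun Φ hΦ hΦm h₃m u j j' => hα L ι H T hT hdef h2 μ Φ Φ₃ (hNA hΦ) hΦ₃ hΦm h₃m (horth Φ hΦ hΦm h₃m) u j j')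

/-- `OrthVanish (antihol) P` from S2⁻ and S2β. [cite: BorelWallach2000, VII 2.10, 3.2] [cite: HarishChandraTAMS1953, Cor. to Thm 2] -/
theorem orthVanish_antihol (hα : ArchOrthAntiholType) (hβ : DensityType)
    (hdef : ∀ τ' : L →+* ℂ, InfinitePlace.mk τ' ≠ InfinitePlace.mk ι → (H.map τ').PosDef)
    (h2 : 2 ≤ Module.finrank ℚ ↥(maximalRealSubfield L))
    (μ : Measure (𝒰 L H).automorphicQuotient) [(𝒰 L H).IsAutomorphicMeasure μ] (P : DiscreteAutomorphicRep (𝒰 L H) μ) :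
    OrthVanish (antihol L ι H T hT) P := by
  intro N' hNA hNP hNst hN0 Φ₃ hΦ₃ hP₃ horth
  exact hβ L ι H T hT hdef h2 μ P N' (fun Φ hΦ => antihol_le_coh L ι H T hT (hNA hΦ)) hNP hNst hN0 Φ₃
    (antihol_le_coh L ι H T hT hΦ₃) hP₃
    (fun Φ hΦ hΦm h₃m u j j' => hα L ι H T hT hdef h2 μ Φ Φ₃ (hNA hΦ) hΦ₃ hΦm h₃m (horth Φ hΦ hΦm h₃m) u j j')

end CM

/-! ## §5 THE HEADS — sorry-free compositions concluding the (E) letters (fold binders `hEhol` / `hEantihol` verbatim; filed letters by name) -/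

/-- **HEAD (E-hol, admissible binder) = F0P3-p03's `hEhol` TOKEN FOR TOKEN.** [cite: Liu2021, Lem. D.2 (2)] [cite: BorelWallach2000, VI 4.11; VII 3.2] -/
theorem cohIsotypicLineAdm_hol_of (hS : SesqSchurType) (hα : ArchOrthHolType) (hβ : DensityType) :
    ∀ (L : Type) [Field L] [NumberField L] [IsCMField L] (ι : L →+* ℂ) (H : Matrix (Fin 3) (Fin 3) L) (T : GL (Fin 3) ℂ)
      (hT : (T : Matrix (Fin 3) (Fin 3) ℂ)ᴴ * H.map ι * (T : Matrix (Fin 3) (Fin 3) ℂ) = Literature.Geometry.ComplexHyperbolic.BallModel.J),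
      (∀ τ' : L →+* ℂ, InfinitePlace.mk τ' ≠ InfinitePlace.mk ι → (H.map τ').PosDef) →
      2 ≤ Module.finrank ℚ ↥(maximalRealSubfield L) →
      ∀ (μ : Measure (adelicGroupData (↥(maximalRealSubfield L)) L (IsCMField.complexConj L) 3 H).automorphicQuotient)
      [(adelicGroupData (↥(maximalRealSubfield L)) L (IsCMField.complexConj L) 3 H).IsAutomorphicMeasure μ]
      (W : Type) [AddCommGroup W] [Module ℂ W]
      (σ : Representation ℂ (finAdelic (↥(maximalRealSubfield L)) L (IsCMField.complexConj L) 3 H) W),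
      σ.IsIrreducible → σ.IsSmooth → σ.IsAdmissible →
      ∀ P : DiscreteAutomorphicRep (adelicGroupData (↥(maximalRealSubfield L)) L (IsCMField.complexConj L) 3 H) μ,
      ∃ ψ₀ : W →ₗ[ℂ] ((adelicGroupData (↥(maximalRealSubfield L)) L (IsCMField.complexConj L) 3 H).Adelic → (Fin 2 → ℂ)),
      ∀ ψ : W →ₗ[ℂ] ((adelicGroupData (↥(maximalRealSubfield L)) L (IsCMField.complexConj L) 3 H).Adelic → (Fin 2 → ℂ)),
      (∀ (g : finAdelic (↥(maximalRealSubfield L)) L (IsCMField.complexConj L) 3 H) (w : W),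
      ψ (σ g w) = CotangentForms.rightRep (↥(maximalRealSubfield L)) L (IsCMField.complexConj L) 3 H g (ψ w)) →
      (∀ w : W, ψ w ∈ CotangentForms.holCotForms (↥(maximalRealSubfield L)) L (IsCMField.complexConj L) 3 H (cmArchSection L ι H T hT)
      (cmCompactFactor L ι H T hT) ∧ P.ContainsForm (ψ w)) →
      ∃ r : ℂ, ψ = r • ψ₀ := by
  intro L _ _ _ ι H T hT hdef h2 μ _ W _ _ σ hirr _ hadm P
  by_cases hex : ∃ ψ₁ : W →ₗ[ℂ] ((𝒰 L H).Adelic → (Fin 2 → ℂ)),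
      (∀ (g : Gf L H) (w : W), ψ₁ (σ g w) = Rf L H g (ψ₁ w)) ∧ (∀ w : W, ψ₁ w ∈ hol L ι H T hT ∧ P.ContainsForm (ψ₁ w)) ∧ ψ₁ ≠ 0
  · obtain ⟨ψ₁, hE₁, hV₁, hne⟩ := hex
    exact ⟨ψ₁, fun ψ hE hV => exists_eq_smul_of_orthVanish hS P (hol L ι H T hT) (fun Φ hΦ => leftInvariant_of_mem_holCotForms hΦ)
      (orthVanish_hol hα hβ hdef h2 μ P) σ hirr hadm ψ₁ ψ hE₁ hV₁ hne hE hV⟩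
  · refine ⟨0, fun ψ hE hV => ⟨0, ?_⟩⟩
    push Not at hex
    rw [hex ψ hE hV, smul_zero]

/-- **HEAD (E-antihol, admissible binder) = F0P3-p03's `hEantihol` TOKEN FOR TOKEN.** [cite: Liu2021, Lem. D.2 (2)] [cite: BorelWallach2000, VII 2.10, 3.2] -/
theorem cohIsotypicLineAdm_antihol_of (hS : SesqSchurType) (hα : ArchOrthAntiholType) (hβ : DensityType) :
    ∀ (L : Type) [Field L] [NumberField L] [IsCMField L] (ι : L →+* ℂ) (H : Matrix (Fin 3) (Fin 3) L) (T : GL (Fin 3) ℂ)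
      (hT : (T : Matrix (Fin 3) (Fin 3) ℂ)ᴴ * H.map ι * (T : Matrix (Fin 3) (Fin 3) ℂ) = Literature.Geometry.ComplexHyperbolic.BallModel.J),
      (∀ τ' : L →+* ℂ, InfinitePlace.mk τ' ≠ InfinitePlace.mk ι → (H.map τ').PosDef) →
      2 ≤ Module.finrank ℚ ↥(maximalRealSubfield L) →
      ∀ (μ : Measure (adelicGroupData (↥(maximalRealSubfield L)) L (IsCMField.complexConj L) 3 H).automorphicQuotient)
      [(adelicGroupData (↥(maximalRealSubfield L)) L (IsCMField.complexConj L) 3 H).IsAutomorphicMeasure μ]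
      (W : Type) [AddCommGroup W] [Module ℂ W]
      (σ : Representation ℂ (finAdelic (↥(maximalRealSubfield L)) L (IsCMField.complexConj L) 3 H) W),
      σ.IsIrreducible → σ.IsSmooth → σ.IsAdmissible →
      ∀ P : DiscreteAutomorphicRep (adelicGroupData (↥(maximalRealSubfield L)) L (IsCMField.complexConj L) 3 H) μ,
      ∃ ψ₀ : W →ₗ[ℂ] ((adelicGroupData (↥(maximalRealSubfield L)) L (IsCMField.complexConj L) 3 H).Adelic → (Fin 2 → ℂ)),
      ∀ ψ : W →ₗ[ℂ] ((adelicGroupData (↥(maximalRealSubfield L)) L (IsCMField.complexConj L) 3 H).Adelic → (Fin 2 → ℂ)),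
      (∀ (g : finAdelic (↥(maximalRealSubfield L)) L (IsCMField.complexConj L) 3 H) (w : W),
      ψ (σ g w) = CotangentForms.rightRep (↥(maximalRealSubfield L)) L (IsCMField.complexConj L) 3 H g (ψ w)) →
      (∀ w : W, ψ w ∈ (CotangentForms.holCotForms (↥(maximalRealSubfield L)) L (IsCMField.complexConj L) 3 H (cmArchSection L ι H T hT)
      (cmCompactFactor L ι H T hT)).map (CotangentForms.conjFun (↥(maximalRealSubfield L)) L (IsCMField.complexConj L) 3 H) ∧
      P.ContainsForm (ψ w)) →
      ∃ r : ℂ, ψ = r • ψ₀ := by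
  intro L _ _ _ ι H T hT hdef h2 μ _ W _ _ σ hirr _ hadm P
  by_cases hex : ∃ ψ₁ : W →ₗ[ℂ] ((𝒰 L H).Adelic → (Fin 2 → ℂ)),
      (∀ (g : Gf L H) (w : W), ψ₁ (σ g w) = Rf L H g (ψ₁ w)) ∧ (∀ w : W, ψ₁ w ∈ antihol L ι H T hT ∧ P.ContainsForm (ψ₁ w)) ∧ ψ₁ ≠ 0
  · obtain ⟨ψ₁, hE₁, hV₁, hne⟩ := hex
    exact ⟨ψ₁, fun ψ hE hV => exists_eq_smul_of_orthVanish hS P (antihol L ι H T hT) (fun Φ hΦ => leftInvariant_of_mem_antihol L ι H T hT hΦ)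
      (orthVanish_antihol hα hβ hdef h2 μ P) σ hirr hadm ψ₁ ψ hE₁ hV₁ hne hE hV⟩
  · refine ⟨0, fun ψ hE hV => ⟨0, ?_⟩⟩
    push Not at hex
    rw [hex ψ hE hV, smul_zero]

/-- **HEAD (E-hol, FILED letter by name):** ★ `CotangentForms.cohIsotypicLine_hol` (no admissibility binder) from S1, S2⁺, S2β and S3.
[cite: Liu2021, Lem. D.2 (2)] [cite: BorelWallach2000, VI 4.11; VII 3.2] -/
theorem cohIsotypicLine_hol_of (hS : SesqSchurType) (hα : ArchOrthHolType) (hβ : DensityType) (hadmf : AdmissibleOfCohValuedType) :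
    Literature.NumberTheory.Automorphic.UnitaryGroup.CotangentForms.cohIsotypicLine_hol := by
  intro L _ _ _ ι H T hT hdef h2 μ _ W _ _ σ hirr hsm P
  by_cases hex : ∃ ψ₁ : W →ₗ[ℂ] ((𝒰 L H).Adelic → (Fin 2 → ℂ)),
      (∀ (g : Gf L H) (w : W), ψ₁ (σ g w) = Rf L H g (ψ₁ w)) ∧ (∀ w : W, ψ₁ w ∈ hol L ι H T hT ∧ P.ContainsForm (ψ₁ w)) ∧ ψ₁ ≠ 0
  · obtain ⟨ψ₁, hE₁, hV₁, hne⟩ := hex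
    have hadm : σ.IsAdmissible :=
      hadmf L ι H T hT hdef h2 W σ hirr hsm ψ₁ hE₁ (fun w => CotangentForms.holCotForms_le_cohForms (hV₁ w).1) hne
    exact ⟨ψ₁, fun ψ hE hV => exists_eq_smul_of_orthVanish hS P (hol L ι H T hT) (fun Φ hΦ => leftInvariant_of_mem_holCotForms hΦ)
      (orthVanish_hol hα hβ hdef h2 μ P) σ hirr hadm ψ₁ ψ hE₁ hV₁ hne hE hV⟩
  · refine ⟨0, fun ψ hE hV => ⟨0, ?_⟩⟩
    push Not at hex
    rw [hex ψ hE hV, smul_zero]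

/-- **HEAD (E-antihol, FILED letter by name):** ★ `CotangentForms.cohIsotypicLine_antihol` from S1, S2⁻, S2β and S3.
[cite: Liu2021, Lem. D.2 (2)] [cite: BorelWallach2000, VII 2.10, 3.2] -/
theorem cohIsotypicLine_antihol_of (hS : SesqSchurType) (hα : ArchOrthAntiholType) (hβ : DensityType)
    (hadmf : AdmissibleOfCohValuedType) :
    Literature.NumberTheory.Automorphic.UnitaryGroup.CotangentForms.cohIsotypicLine_antihol := by
  intro L _ _ _ ι H T hT hdef h2 μ _ W _ _ σ hirr hsm P
  by_cases hex : ∃ ψ₁ : W →ₗ[ℂ] ((𝒰 L H).Adelic → (Fin 2 → ℂ)),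
      (∀ (g : Gf L H) (w : W), ψ₁ (σ g w) = Rf L H g (ψ₁ w)) ∧ (∀ w : W, ψ₁ w ∈ antihol L ι H T hT ∧ P.ContainsForm (ψ₁ w)) ∧ ψ₁ ≠ 0
  · obtain ⟨ψ₁, hE₁, hV₁, hne⟩ := hex
    have hadm : σ.IsAdmissible :=
      hadmf L ι H T hT hdef h2 W σ hirr hsm ψ₁ hE₁ (fun w => antihol_le_coh L ι H T hT (hV₁ w).1) hne
    exact ⟨ψ₁, fun ψ hE hV => exists_eq_smul_of_orthVanish hS P (antihol L ι H T hT) (fun Φ hΦ => leftInvariant_of_mem_antihol L ι H T hT hΦ)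
      (orthVanish_antihol hα hβ hdef h2 μ P) σ hirr hadm ψ₁ ψ hE₁ hV₁ hne hE hV⟩
  · refine ⟨0, fun ψ hE hV => ⟨0, ?_⟩⟩
    push Not at hex
    rw [hex ψ hE hV, smul_zero]

/-! ## §6 The registered-stub instances of the heads (what the S3/S4 folds consume) -/

-- The fold binders are consumed BY TERM: `hEhol := cohIsotypicLineAdm_hol_of stub_sesqSchur stub_archOrth_hol stub_density`,
-- `hEantihol := cohIsotypicLineAdm_antihol_of stub_sesqSchur stub_archOrth_antihol stub_density` (types = the binder texts above).

/-- The filed letter ★ `CotangentForms.cohIsotypicLine_hol` from S1, S2⁺, S2β, S3. [cite: Liu2021, Lem. D.2 (2)] -/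
theorem cohIsotypicLine_hol_of_stubs : Literature.NumberTheory.Automorphic.UnitaryGroup.CotangentForms.cohIsotypicLine_hol :=
  cohIsotypicLine_hol_of stub_sesqSchur stub_archOrth_hol stub_density stub_admissible_of_cohValued

/-- The filed letter ★ `CotangentForms.cohIsotypicLine_antihol` from S1, S2⁻, S2β, S3. [cite: Liu2021, Lem. D.2 (2)] -/
theorem cohIsotypicLine_antihol_of_stubs : Literature.NumberTheory.Automorphic.UnitaryGroup.CotangentForms.cohIsotypicLine_antihol :=
  cohIsotypicLine_antihol_of stub_sesqSchur stub_archOrth_antihol stub_density stub_admissible_of_cohValued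

end Summit.HodgeConjecture.HodgeConjecture.Cruxes.H413.F0P2aCohIsotypicLine

end
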